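import Summits.CriticalPhenomena.Ising3DConformalLimit.Theses.PerfectScreening
import Summits.CriticalPhenomena.Ising3DConformalLimit.Theorems.SubPtolemyInterlacingSubPtolemyFloorHybridCloses
import Summits.CriticalPhenomena.Ising3DConformalLimit.Theorems.GaussianLimitNotScreened.Negative.Reformulation
import Summits.CriticalPhenomena.Ising3DConformalLimit.Theorems.PerfectScreeningGaussianLimitNotScreenedSplit
import HarnessLib

/-!
# Crux `GaussianLimitNotScreened` (stmt-CriticalPhenomena-13886): the INTERLACING bridges (lead c4)

THEOREM-ONLY file (no definitions, no named facts). A payer of a NEW KIND for the amplitude leaf (α)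
`AmplitudeAtHalf` of the three-regime split of the crux (`PerfectScreeningGaussianLimitNotScreenedSplit`, p137467):
the sub-Ptolemy INTERLACING inequality of route `SubPtolemyInterlacing` (item stmt-CriticalPhenomena-15702,
`Theses.SubPtolemyInterlacing.Interlacing`: for all axis quadruples `(0, a, a+b, a+b+c)·e₁` at `β_c(3)`,
`S₄ · P_cross ≤ P_s · P_t` for the three pairings) — a LATTICE four-point correlation inequality, homogeneous of
degree `0` in the normalisation, falsifiable by Monte Carlo, and FALSE for every lattice-Gaussian (Wick) family
with a `1/r`-type kernel (at `x⋆ = (0,2,3,6)·n·e₁`, Wick gives `S₄ P_c = (5/144) n⁻⁴ > P_s P_t = (1/36) n⁻⁴`), so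
it passes the crux disprover's admissibility test (A1) (`Cruxes/GaussianLimitNotScreened/STRATEGY-CENSUS.md` §2: a
lever for (α) must FAIL on the screened hafnian witness `screenedLatticeAll`).

Mechanism (all landed in `Theorems/SubPtolemyInterlacingSubPtolemyFloorHybridCloses.lean`,
`SubPtolemyFloorHybrid.hasNontrivialU4_of_interlacing_of_window`): `Interlacing` passes to any non-degenerate
translation-invariant scale-covariant pointwise limit and forces `U₄(x⋆) ≤ s₁s₃(1 − 2u − u²) < 0`,
`u = 2^{−2Δ}`, whenever `2Δ < log₂(1+√2) ≈ 1.2716`; in particular NO GAUSSIAN Möbius limit with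
`Δ < 0.6358` exists, which settles (α) (`Δ = 1/2`, `one_lt_threshold`) by vacuity and the lower part
`(1/2, log₂(1+√2)/2)` of the window leaf (β). Consequences for the crux, kernel-checked here:

* `stub_interlacingPaysAmplitude : Interlacing → (α)` (registered bookkeeping statement of the crux);
* `noGaussianLimitBelowThreshold_of_interlacing` : `Interlacing →` no Gaussian Möbius limit with `2Δ < log₂(1+√2)`;
* `gaussianLimitNotScreened_of_interlacing_of_upperWindow_of_corner` : with `Interlacing`, the crux REDUCES to
  excluding Gaussian Möbius limits with `log₂(1+√2)/2 ≤ Δ < 3/4` and at the corner `Δ = 3/4` (both automatically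
  screened regimes; payers 0636 / 2601 / 5507);
* `gaussianLimitNotScreened_of_interlacing_of_gaussianLimitIsFree` : `Interlacing ∧` item 2601 `⇒` crux;
* `gaussianLimitNotScreened_of_interlacing_of_conditionalEta` / `…_of_subPtolemyFloor` : `Interlacing ∧`
  (`η(3) < log₂(1+√2) − 1` if `η` exists, resp. item 15703 `SubPtolemyFloor`) `⇒` crux (indeed no Möbius limit of
  `criticalCorr 3` is then Gaussian at all).

References: Aizenman CMP 86 (1982) §1 (`U₄`, Lebowitz sign); Duminil-Copin ICM 2022 §8.1 (covariance bookkeeping);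
Duminil-Copin–Panis 2025 Thm 1.5 (the window `Δ ≤ 3/4`).
-/

noncomputable section

namespace Summit.CriticalPhenomena.Ising3DConformalLimit.Cruxes.GaussianLimitNotScreened.FreeRegularVariationDcpWindow

open Filter Topology
open Literature.Probability.LatticeModels
open Summit.CriticalPhenomena.Ising3DConformalLimit.Theses.SubPtolemyInterlacing (Interlacing SubPtolemyFloor)
open Summit.CriticalPhenomena.Ising3DConformalLimit.SubPtolemyFloorHybrid
  (hasNontrivialU4_of_interlacing_of_window hasNontrivialU4_of_interlacing_of_conditionalEta
    conditionalEta_of_subPtolemyFloor)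
open Summit.CriticalPhenomena.Ising3DConformalLimit.SubPtolemyFloorNegative (one_lt_threshold)
open Summit.CriticalPhenomena.Ising3DConformalLimit.GaussianLimitNotScreenedNegative
  (dimension_window_and_eta screened_iff_renorm)
open Summit.CriticalPhenomena.Ising3DConformalLimit.PerfectScreeningGaussianLimitNotScreenedSplit
  (gaussianLimitNotScreened_of_subs)

/-- **`Interlacing` excludes every Gaussian Möbius limit below the sub-Ptolemy threshold**: a non-degenerate
Möbius-covariant pointwise scaling limit of `criticalCorr 3` with `2Δ < log₂(1+√2)` has `U₄ ≢ 0` (translation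
invariance and scale covariance read off Möbius covariance; landed `hasNontrivialU4_of_interlacing_of_window`).
[cite: Aizenman1982, §1] -/
theorem noGaussianLimitBelowThreshold_of_interlacing (hI : Interlacing) :
    ∀ (ρ : ℝ → ℝ) (Δ : ℝ) (S : CorrFamily 3), (∀ δ ∈ Set.Ioc (0:ℝ) 1, 0 < ρ δ) →
      HasPointwiseScalingLimit (criticalCorr 3) ρ S → IsNondegenerateTwoPoint S →
      IsMoebiusCovariant Δ S → 2 * Δ < Real.logb 2 (1 + Real.sqrt 2) → HasNontrivialU4 S :=
  fun _ _ _ _ hlim hnd hM hΔ =>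
    hasNontrivialU4_of_interlacing_of_window hI hlim hnd hM.isEuclideanInvariant.1 hM.isScaleCovariant hΔ

/-- **Registered bookkeeping statement `stub_interlacingPaysAmplitude` of the crux: `Interlacing` pays the
amplitude leaf (α).** At `Δ = 1/2` we have `2Δ = 1 < log₂(1+√2)` (`one_lt_threshold`), so `Interlacing` makes
every non-degenerate Möbius limit with `Δ = 1/2` non-Gaussian, and (α) — a statement about GAUSSIAN limits at
`Δ = 1/2` — holds vacuously. A payer of a new kind for (α): a lattice four-point inequality that is false for Wick
families (admissibility test (A1) of the crux census), not an amplitude rigidity. [cite: Aizenman1982, §1] -/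
theorem stub_interlacingPaysAmplitude :
    Summit.CriticalPhenomena.Ising3DConformalLimit.Theses.SubPtolemyInterlacing.Interlacing →
    ∀ (ρ : ℝ → ℝ) (S : CorrFamily 3), (∀ δ ∈ Set.Ioc (0:ℝ) 1, 0 < ρ δ) →
      HasPointwiseScalingLimit (criticalCorr 3) ρ S → IsNondegenerateTwoPoint S →
      IsMoebiusCovariant (1/2) S → ¬ HasNontrivialU4 S →
      ¬ Tendsto (fun m : ℕ => ρ (1 / m) ^ 2 / m) atTop atTop := by
  intro hI ρ S hρ hlim hnd hM hU4 _
  refine hU4 (noGaussianLimitBelowThreshold_of_interlacing hI ρ (1/2) S hρ hlim hnd hM ?_)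
  have h := one_lt_threshold
  linarith

/-- **`Interlacing` pays the lower part of the window leaf (β)**: no Gaussian Möbius limit with
`1/2 < Δ < log₂(1+√2)/2 ≈ 0.6358`. [cite: Aizenman1982, §1] -/
theorem noGaussianWindowLimit_below_of_interlacing (hI : Interlacing) :
    ∀ (ρ : ℝ → ℝ) (Δ : ℝ) (S : CorrFamily 3), (∀ δ ∈ Set.Ioc (0:ℝ) 1, 0 < ρ δ) →
      HasPointwiseScalingLimit (criticalCorr 3) ρ S → IsNondegenerateTwoPoint S →
      IsMoebiusCovariant Δ S → 1 / 2 < Δ → 2 * Δ < Real.logb 2 (1 + Real.sqrt 2) → HasNontrivialU4 S :=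
  fun ρ Δ S hρ hlim hnd hM _ hΔ => noGaussianLimitBelowThreshold_of_interlacing hI ρ Δ S hρ hlim hnd hM hΔ

/-- **With `Interlacing`, the window leaf (β) reduces to its UPPER part** `log₂(1+√2)/2 ≤ Δ < 3/4`.
[cite: Aizenman1982, §1] -/
theorem noGaussianWindowLimit_of_interlacing_of_upperWindow (hI : Interlacing)
    (hUp : ∀ (ρ : ℝ → ℝ) (Δ : ℝ) (S : CorrFamily 3), (∀ δ ∈ Set.Ioc (0:ℝ) 1, 0 < ρ δ) →
      HasPointwiseScalingLimit (criticalCorr 3) ρ S → IsNondegenerateTwoPoint S →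
      IsMoebiusCovariant Δ S → Real.logb 2 (1 + Real.sqrt 2) ≤ 2 * Δ → Δ < 3 / 4 → HasNontrivialU4 S) :
    ∀ (ρ : ℝ → ℝ) (Δ : ℝ) (S : CorrFamily 3), (∀ δ ∈ Set.Ioc (0:ℝ) 1, 0 < ρ δ) →
      HasPointwiseScalingLimit (criticalCorr 3) ρ S → IsNondegenerateTwoPoint S →
      IsMoebiusCovariant Δ S → 1 / 2 < Δ → Δ < 3 / 4 → HasNontrivialU4 S := by
  intro ρ Δ S hρ hlim hnd hM hgt hlt
  rcases lt_or_ge (2 * Δ) (Real.logb 2 (1 + Real.sqrt 2)) with hbelow | habove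
  · exact noGaussianLimitBelowThreshold_of_interlacing hI ρ Δ S hρ hlim hnd hM hbelow
  · exact hUp ρ Δ S hρ hlim hnd hM habove hlt

/-- **THE CRUX, REDUCED BY `Interlacing`**: given `Interlacing`, `GaussianLimitNotScreened` follows from the two
automatically-screened regimes alone — no Gaussian Möbius limit with `log₂(1+√2)/2 ≤ Δ < 3/4` (upper window)
and none at the corner `Δ = 3/4` — through the landed split glue, the amplitude leaf being paid by
`stub_interlacingPaysAmplitude`. [cite: DuminilCopinPanis2025LowerBounds, Theorem 1.5] [cite: Aizenman1982, §1] -/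
theorem gaussianLimitNotScreened_of_interlacing_of_upperWindow_of_corner (hI : Interlacing)
    (hUp : ∀ (ρ : ℝ → ℝ) (Δ : ℝ) (S : CorrFamily 3), (∀ δ ∈ Set.Ioc (0:ℝ) 1, 0 < ρ δ) →
      HasPointwiseScalingLimit (criticalCorr 3) ρ S → IsNondegenerateTwoPoint S →
      IsMoebiusCovariant Δ S → Real.logb 2 (1 + Real.sqrt 2) ≤ 2 * Δ → Δ < 3 / 4 → HasNontrivialU4 S)
    (hγ : ∀ (ρ : ℝ → ℝ) (S : CorrFamily 3), (∀ δ ∈ Set.Ioc (0:ℝ) 1, 0 < ρ δ) →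
      HasPointwiseScalingLimit (criticalCorr 3) ρ S → IsNondegenerateTwoPoint S →
      IsMoebiusCovariant (3 / 4) S → HasNontrivialU4 S) :
    Summit.CriticalPhenomena.Ising3DConformalLimit.Theses.PerfectScreening.GaussianLimitNotScreened :=
  gaussianLimitNotScreened_of_subs (noGaussianWindowLimit_of_interlacing_of_upperWindow hI hUp) hγ
    (stub_interlacingPaysAmplitude hI)

/-- **`Interlacing ∧` item stmt-CriticalPhenomena-2601 `GaussianLimitIsFree ⇒` the crux**: a Gaussian Möbius
limit would have `Δ = 1/2` (item 2601), where `Interlacing` forbids Gaussianity; so no Gaussian Möbius limit of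
`criticalCorr 3` exists and the crux holds vacuously (cf. the landed `SubPtolemyFloorHybrid.hybrid_closes`).
[cite: Kotani1973, Theorem 2] [cite: Aizenman1982, §1] -/
theorem gaussianLimitNotScreened_of_interlacing_of_gaussianLimitIsFree (hI : Interlacing)
    (hfree : Summit.CriticalPhenomena.Ising3DConformalLimit.Theses.AnomalousForcesInteraction.GaussianLimitIsFree) :
    Summit.CriticalPhenomena.Ising3DConformalLimit.Theses.PerfectScreening.GaussianLimitNotScreened := by
  intro ρ Δ S hρ hlim hnd hM hU4 _
  have hΔ : Δ = 1 / 2 := hfree ρ Δ S hρ hlim hnd hM.isEuclideanInvariant.1 hM.isScaleCovariant hU4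
  refine hU4 (noGaussianLimitBelowThreshold_of_interlacing hI ρ Δ S hρ hlim hnd hM ?_)
  rw [hΔ]
  have h := one_lt_threshold
  linarith

/-- **`Interlacing ∧` the conditional exponent inequality `⇒` the crux**: if every existing `η(3)` satisfies
`η < log₂(1+√2) − 1`, then every non-degenerate Möbius limit of `criticalCorr 3` sits below the threshold
(`η = 2Δ − 1` exists for it) and `Interlacing` makes it non-Gaussian (landed
`hasNontrivialU4_of_interlacing_of_conditionalEta`); the crux holds vacuously.
[cite: DuminilCopinPanis2025LowerBounds, Theorem 1.5] -/
theorem gaussianLimitNotScreened_of_interlacing_of_conditionalEta (hI : Interlacing)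
    (hC : ∀ η : ℝ, HasIsingExponentEta 3 η → η < Real.logb 2 (1 + Real.sqrt 2) - 1) :
    Summit.CriticalPhenomena.Ising3DConformalLimit.Theses.PerfectScreening.GaussianLimitNotScreened :=
  fun _ _ _ hρ hlim hnd hM hU4 _ =>
    hU4 (hasNontrivialU4_of_interlacing_of_conditionalEta hI hC hρ hlim hnd hM.isEuclideanInvariant.1
      hM.isScaleCovariant)

/-- **`Interlacing ∧` item stmt-CriticalPhenomena-15703 `SubPtolemyFloor ⇒` the crux** (the floor implies the
conditional exponent inequality, landed `conditionalEta_of_subPtolemyFloor`). So route `SubPtolemyInterlacing`'s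
two cruxes pay r4 of route `PerfectScreening` outright. [cite: DuminilCopinPanis2025LowerBounds, Theorem 1.5] -/
theorem gaussianLimitNotScreened_of_interlacing_of_subPtolemyFloor (hI : Interlacing) (hF : SubPtolemyFloor) :
    Summit.CriticalPhenomena.Ising3DConformalLimit.Theses.PerfectScreening.GaussianLimitNotScreened :=
  gaussianLimitNotScreened_of_interlacing_of_conditionalEta hI (conditionalEta_of_subPtolemyFloor hF)

end Summit.CriticalPhenomena.Ising3DConformalLimit.Cruxes.GaussianLimitNotScreened.FreeRegularVariationDcpWindow

end
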